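import Summits.NavierStokesRegularity.NavierStokesRegularity.Theorems.StrainDoorsSegregationRigidity
import HarnessLib

/-!
# Strain doors — RIGIDITY OF FAVOURABLE SEGREGATION (the pointwise sign hypothesis of door D11 is rigid) — PART 2/2 (§23–§25, kernel form and Navier–Stokes)

Door D11 «MagicConeDoor» (R48) asks, at every charged near-record strain point `(x,e)`, for the POINTWISE
favourable segregation of the Q-excess: `K_ee(x − y)(q(y) − q(x)) ≥ 0` for all `y`, where inside the inner
radius `K_ee(z) = (|z|² − 3⟨z,e⟩²)/(4π|z|⁵)` changes sign across the magic cone `3⟨z,e⟩² = |z|²`.  This file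
proves that the pointwise sign is RIGID:

* §22 (pure calculus, any `C²` scalar field `q` on `ℝ³`, unit `e`, radius `ρ > 0`).  If `q(x+z) ≤ q(x)` for
  `z` in the open inner cone and `q(x+z) ≥ q(x)` for `z` in the open outer cone (`|z| < ρ`), then
  `∇q(x) = 0` (`fderiv_eq_zero_of_coneSegregated`), the Hessian is the uniaxial quadrupole
  `D²q(x)(v,v) = (a/2)(3⟨v,e⟩² − |v|²)` with `a = D²q(x)(e,e) ≤ 0` (`hess_eq_of_coneSegregated`,
  `hess_self_nonpos_of_coneSegregated`), and hence `Δq(x) = 0` (`laplacian_eq_zero_of_coneSegregated`).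
* §23 (kernel form).  D11's hypothesis (i) with `0 < r₀ < r₁` implies the cone form with `ρ = r₀`
  (`coneSegregated_of_segregated`, from the tree's `newtonNearHess_self_eq_quadrupole`).
* §24 (Navier–Stokes).  At a point of favourable segregation of a classical solution: `∇(Δp) = 0`,
  `Δ²p = 0` and `D²(Δp)` is the compressed uniaxial quadrupole along `e` (`q = Δp`); if (i) holds at every
  point of a ball then `q = Δp` is CONSTANT on the ball (`qDensity_eq_of_segregated_on_ball`); and under the
  full hypothesis of D11 at a time `t`, `q` is locally constant around every strictly sub-tolerance charged
  almost-record strain point (`qDensity_locallyConst_of_D11_hypothesis`) — the door's antecedent forces the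
  near field of the record region to be «pressure-Laplacian flat», as in a pure stretched shear layer.

* §25 (modulo analyticity).  With real-analyticity and integrability of `q(t,·)` as explicit hypotheses (true for mild
  solutions at `t > 0` by Masuda/Kahane/Foias–Temam, not typed here), D11's segregation hypothesis at time `t` forces
  `q(t,·) ≡ 0` on `ℝ³` and `Δp(t,·) ≡ 0` (`qDensity_eq_zero_of_D11_hypothesis_of_analytic`).

LANDING NOTE (ns-s29-p2 g5): nsreg-p1 g34's ROUND-49 text `StrainDoorsSegregationRigidity.lean` (sha16 289ea2a845865ffa, 583 l.)
exceeds the gate's 400-line cap and is landed BY SECTION in two modules with every declaration byte-identical: PART 1 =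
§22 (`Theorems/StrainDoorsSegregationRigidity`), PART 2 = §23–§25 (`Theorems/StrainDoorsSegregationRigidityNS`, imports PART 1).
`--supports stmt-NavierStokesRegularity-0056 --as helper`. HONEST FRAME: rigidity of a door HYPOTHESIS; 0056 / 10661 / NS regularity NOT proved.
Nothing here is a regularity statement; it is negative knowledge about the strength of a door hypothesis.
-/

noncomputable section

open MeasureTheory Set Function Filter InnerProductSpace Metric
open scoped RealInnerProductSpace Laplacian ContDiff Topology
open Real Literature.Analysis.FluidPDE Literature.Analysis.FluidPDE.VorticityDirectionDynamics

set_option linter.dupNamespace false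
set_option linter.unusedSectionVars false

namespace Summit.NavierStokesRegularity.NavierStokesRegularity.Theorems.StrainDoors

/-! ## §23  From the kernel sign hypothesis (i) of door D11 to cone segregation -/

/-- support: hypothesis (i) of door D11 — `K_ee(x−y)(q(y) − q(x)) ≥ 0` for all `y` — implies cone segregation
of `q` at `x` along `e` within the inner radius `r₀` (the kernel is the exact quadrupole there). -/
theorem coneSegregated_of_segregated {r₀ r₁ : ℝ} (hr₀ : 0 < r₀) (hr₁ : r₀ < r₁) {e : EuclideanSpace ℝ (Fin 3)}
    (he : ‖e‖ = 1) {q : EuclideanSpace ℝ (Fin 3) → ℝ} {x : EuclideanSpace ℝ (Fin 3)}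
    (h : ∀ y, 0 ≤ newtonNearHess r₀ r₁ e e (x - y) * (q y - q x)) :
    ∀ z : EuclideanSpace ℝ (Fin 3), ‖z‖ < r₀ →
      (‖z‖ ^ 2 < 3 * ⟪z, e⟫ ^ 2 → q (x + z) ≤ q x) ∧ (3 * ⟪z, e⟫ ^ 2 < ‖z‖ ^ 2 → q x ≤ q (x + z)) := by
  intro z hz
  have hy := h (x + z)
  rw [show x - (x + z) = -z by abel] at hy
  have key : z ≠ 0 → newtonNearHess r₀ r₁ e e (-z) = (‖z‖ ^ 2 - 3 * ⟪z, e⟫ ^ 2) / (4 * π * ‖z‖ ^ 5) := by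
    intro hz0
    rw [newtonNearHess_self_eq_quadrupole hr₀.le hr₁ (neg_ne_zero.2 hz0) (by rwa [norm_neg]),
      norm_neg, inner_neg_left, neg_sq, he]
    ring
  constructor
  · intro hin
    have hz0 : z ≠ 0 := by rintro rfl; simp at hin
    have hzn : 0 < ‖z‖ := norm_pos_iff.2 hz0
    have hK : newtonNearHess r₀ r₁ e e (-z) < 0 := by
      rw [key hz0]
      exact div_neg_of_neg_of_pos (by linarith) (by positivity)
    by_contra hcon
    push Not at hcon
    have : newtonNearHess r₀ r₁ e e (-z) * (q (x + z) - q x) < 0 := mul_neg_of_neg_of_pos hK (by linarith)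
    linarith
  · intro hout
    have hz0 : z ≠ 0 := by rintro rfl; simp at hout
    have hzn : 0 < ‖z‖ := norm_pos_iff.2 hz0
    have hK : 0 < newtonNearHess r₀ r₁ e e (-z) := by
      rw [key hz0]
      exact div_pos (by linarith) (by positivity)
    have := (mul_nonneg_iff_of_pos_left hK).1 hy
    linarith

/-! ## §24  Navier–Stokes: what favourable segregation forces on `q = Δp` -/

/-- ★ At a point of favourable segregation of a classical solution (hypothesis (i) of D11 at `(t,x,e)`):
`∇q(t,x) = 0`, i.e. `∇(Δp)(t,x) = 0`. -/
theorem fderiv_qDensity_eq_zero_of_segregated {ν T : ℝ} {u : ℝ → (EuclideanSpace ℝ (Fin 3)) → (EuclideanSpace ℝ (Fin 3))}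
    {p : ℝ → (EuclideanSpace ℝ (Fin 3)) → ℝ} (hsol : IsClassicalNSSolutionOn (Ico 0 T) ν 0 u p) {t : ℝ} (ht : t ∈ Ico 0 T)
    {r₀ r₁ : ℝ} (hr₀ : 0 < r₀) (hr₁ : r₀ < r₁) {x e : EuclideanSpace ℝ (Fin 3)} (he : ‖e‖ = 1)
    (hi : ∀ y, 0 ≤ newtonNearHess r₀ r₁ e e (x - y) * (qDensity u t y - qDensity u t x)) :
    fderiv ℝ (qDensity u t) x = 0 := by
  have hS : UniqueDiffOn ℝ (Ico (0 : ℝ) T) := uniqueDiffOn_Ico 0 T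
  have hΔs : ContDiff ℝ ∞ (fun y => (Δ (p t)) y) := (hsol.smooth_pressure.laplacian hS).contDiff_slice ht
  have hq : qDensity u t = fun y => (Δ (p t)) y := qDensity_eq_laplacian_pressure_fun hsol ht
  have hq2 : ContDiff ℝ 2 (qDensity u t) := hq ▸ contDiff_infty.1 hΔs 2
  exact fderiv_eq_zero_of_coneSegregated (hq2.differentiable two_ne_zero) he hr₀
    (coneSegregated_of_segregated hr₀ hr₁ he hi)

/-- ★ … and the Hessian of `q = Δp` there is the compressed uniaxial quadrupole along `e`:
`D²q(x)(v,v) = (a/2)(3⟨v,e⟩² − |v|²)`, `a = D²q(x)(e,e) ≤ 0`. -/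
theorem hess_qDensity_of_segregated {ν T : ℝ} {u : ℝ → (EuclideanSpace ℝ (Fin 3)) → (EuclideanSpace ℝ (Fin 3))}
    {p : ℝ → (EuclideanSpace ℝ (Fin 3)) → ℝ} (hsol : IsClassicalNSSolutionOn (Ico 0 T) ν 0 u p) {t : ℝ} (ht : t ∈ Ico 0 T)
    {r₀ r₁ : ℝ} (hr₀ : 0 < r₀) (hr₁ : r₀ < r₁) {x e : EuclideanSpace ℝ (Fin 3)} (he : ‖e‖ = 1)
    (hi : ∀ y, 0 ≤ newtonNearHess r₀ r₁ e e (x - y) * (qDensity u t y - qDensity u t x)) :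
    (∀ v, fderiv ℝ (fderiv ℝ (qDensity u t)) x v v =
        (fderiv ℝ (fderiv ℝ (qDensity u t)) x e e / 2) * (3 * ⟪v, e⟫ ^ 2 - ‖v‖ ^ 2)) ∧
      fderiv ℝ (fderiv ℝ (qDensity u t)) x e e ≤ 0 := by
  have hS : UniqueDiffOn ℝ (Ico (0 : ℝ) T) := uniqueDiffOn_Ico 0 T
  have hΔs : ContDiff ℝ ∞ (fun y => (Δ (p t)) y) := (hsol.smooth_pressure.laplacian hS).contDiff_slice ht
  have hq : qDensity u t = fun y => (Δ (p t)) y := qDensity_eq_laplacian_pressure_fun hsol ht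
  have hq2 : ContDiff ℝ 2 (qDensity u t) := hq ▸ contDiff_infty.1 hΔs 2
  have hseg := coneSegregated_of_segregated hr₀ hr₁ he hi
  exact ⟨hess_eq_of_coneSegregated hq2 he hr₀ hseg, hess_self_nonpos_of_coneSegregated hq2 he hr₀ hseg⟩

/-- ★ … and `Δq(t,x) = 0`, i.e. the pressure is BIHARMONIC at the point: `Δ²p(t,x) = 0`. -/
theorem laplacian_qDensity_eq_zero_of_segregated {ν T : ℝ} {u : ℝ → (EuclideanSpace ℝ (Fin 3)) → (EuclideanSpace ℝ (Fin 3))}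
    {p : ℝ → (EuclideanSpace ℝ (Fin 3)) → ℝ} (hsol : IsClassicalNSSolutionOn (Ico 0 T) ν 0 u p) {t : ℝ} (ht : t ∈ Ico 0 T)
    {r₀ r₁ : ℝ} (hr₀ : 0 < r₀) (hr₁ : r₀ < r₁) {x e : EuclideanSpace ℝ (Fin 3)} (he : ‖e‖ = 1)
    (hi : ∀ y, 0 ≤ newtonNearHess r₀ r₁ e e (x - y) * (qDensity u t y - qDensity u t x)) :
    (Δ (qDensity u t)) x = 0 ∧ (Δ (fun y => (Δ (p t)) y)) x = 0 := by
  have hS : UniqueDiffOn ℝ (Ico (0 : ℝ) T) := uniqueDiffOn_Ico 0 T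
  have hΔs : ContDiff ℝ ∞ (fun y => (Δ (p t)) y) := (hsol.smooth_pressure.laplacian hS).contDiff_slice ht
  have hq : qDensity u t = fun y => (Δ (p t)) y := qDensity_eq_laplacian_pressure_fun hsol ht
  have hq2 : ContDiff ℝ 2 (qDensity u t) := hq ▸ contDiff_infty.1 hΔs 2
  have h1 : (Δ (qDensity u t)) x = 0 :=
    laplacian_eq_zero_of_coneSegregated hq2 he hr₀ (coneSegregated_of_segregated hr₀ hr₁ he hi)
  exact ⟨h1, by rw [← hq]; exact h1⟩

/-- ★★ NEAR-VACUITY on balls: if hypothesis (i) of D11 holds at EVERY point of a ball (each point with its own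
unit direction), then `q = ½|ω|² − |S|² = Δp` is CONSTANT on the ball. -/
theorem qDensity_eq_of_segregated_on_ball {ν T : ℝ} {u : ℝ → (EuclideanSpace ℝ (Fin 3)) → (EuclideanSpace ℝ (Fin 3))}
    {p : ℝ → (EuclideanSpace ℝ (Fin 3)) → ℝ} (hsol : IsClassicalNSSolutionOn (Ico 0 T) ν 0 u p) {t : ℝ} (ht : t ∈ Ico 0 T)
    {r₀ r₁ : ℝ} (hr₀ : 0 < r₀) (hr₁ : r₀ < r₁) {c : EuclideanSpace ℝ (Fin 3)} {R : ℝ}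
    (h : ∀ x ∈ ball c R, ∃ e : EuclideanSpace ℝ (Fin 3), ‖e‖ = 1 ∧
      ∀ y, 0 ≤ newtonNearHess r₀ r₁ e e (x - y) * (qDensity u t y - qDensity u t x))
    {x y : EuclideanSpace ℝ (Fin 3)} (hx : x ∈ ball c R) (hy : y ∈ ball c R) :
    qDensity u t x = qDensity u t y := by
  have hS : UniqueDiffOn ℝ (Ico (0 : ℝ) T) := uniqueDiffOn_Ico 0 T
  have hΔs : ContDiff ℝ ∞ (fun y => (Δ (p t)) y) := (hsol.smooth_pressure.laplacian hS).contDiff_slice ht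
  have hq : qDensity u t = fun y => (Δ (p t)) y := qDensity_eq_laplacian_pressure_fun hsol ht
  have hq2 : ContDiff ℝ 2 (qDensity u t) := hq ▸ contDiff_infty.1 hΔs 2
  have hqd : Differentiable ℝ (qDensity u t) := hq2.differentiable two_ne_zero
  refine (convex_ball c R).is_const_of_fderivWithin_eq_zero hqd.differentiableOn ?_ hx hy
  intro z hz
  rw [fderivWithin_of_isOpen isOpen_ball hz]
  obtain ⟨e, he, hi⟩ := h z hz
  exact fderiv_qDensity_eq_zero_of_segregated hsol ht hr₀ hr₁ he hi

/-- support: the strain form is continuous in the point (a classical solution is smooth in space). -/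
theorem continuous_strainQuad_left {ν T : ℝ} {u : ℝ → (EuclideanSpace ℝ (Fin 3)) → (EuclideanSpace ℝ (Fin 3))}
    {p : ℝ → (EuclideanSpace ℝ (Fin 3)) → ℝ} (hsol : IsClassicalNSSolutionOn (Ico 0 T) ν 0 u p) {t : ℝ} (ht : t ∈ Ico 0 T)
    (e : EuclideanSpace ℝ (Fin 3)) : Continuous fun x => strainQuad u t x e := by
  have hsm : ContDiff ℝ ∞ (u t) := hsol.smooth_velocity.contDiff_slice ht
  have hc : Continuous (fderiv ℝ (u t)) := hsm.continuous_fderiv (by simp)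
  unfold strainQuad
  fun_prop

/-- ★★ NEAR-VACUITY OF DOOR D11 (its antecedent makes the Q-field flat around the record region).  Fix a time
`t ∈ [0,T)`, a level `l₀ > 0`, tolerances `δ' < δ < 1` and scales `0 < r₀ < r₁`, and assume the segregation
half of D11's hypothesis at time `t`: every charged `δ`-almost record strain point is favourably segregated
(the parity clause (ii) is not needed).  Then around every `δ'`-almost record point `(x₀,e₀)` with level margin
`l₀ < ((1−δ)/(1−δ'))·λ(x₀,e₀)`, the Q-field `q = ½|ω|² − |S|² = Δp` is CONSTANT on a ball. -/
theorem qDensity_locallyConst_of_D11_hypothesis {ν T : ℝ} {u : ℝ → (EuclideanSpace ℝ (Fin 3)) → (EuclideanSpace ℝ (Fin 3))}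
    {p : ℝ → (EuclideanSpace ℝ (Fin 3)) → ℝ} (hsol : IsClassicalNSSolutionOn (Ico 0 T) ν 0 u p) {t : ℝ} (ht : t ∈ Ico 0 T)
    {δ δ' l₀ r₀ r₁ : ℝ} (hl₀ : 0 < l₀) (hδ'δ : δ' < δ) (hδ1 : δ < 1) (hr₀ : 0 < r₀) (hr₁ : r₀ < r₁)
    (hD11 : ∀ x e, IsStrainAlmostArgmax δ u t x e → l₀ < strainQuad u t x e →
      ∀ y, 0 ≤ newtonNearHess r₀ r₁ e e (x - y) * (qDensity u t y - qDensity u t x))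
    {x₀ e₀ : EuclideanSpace ℝ (Fin 3)} (hx₀ : IsStrainAlmostArgmax δ' u t x₀ e₀)
    (hl : l₀ < (1 - δ) / (1 - δ') * strainQuad u t x₀ e₀) :
    ∃ R > 0, ∀ x ∈ ball x₀ R, qDensity u t x = qDensity u t x₀ := by
  set M₀ := strainQuad u t x₀ e₀ with hM₀
  set κ := (1 - δ) / (1 - δ') with hκ
  have h1δ' : 0 < 1 - δ' := by linarith
  have hκpos : 0 < κ := div_pos (by linarith) h1δ'
  have hκ1 : κ < 1 := (div_lt_one h1δ').2 (by linarith)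
  have hM₀pos : 0 < M₀ := by
    by_contra h
    push Not at h
    have : κ * M₀ ≤ 0 := mul_nonpos_of_nonneg_of_nonpos hκpos.le h
    linarith
  have hθ : κ * M₀ < M₀ := by
    calc κ * M₀ < 1 * M₀ := by gcongr
      _ = M₀ := one_mul _
  have hlt : max l₀ (κ * M₀) < M₀ := max_lt (hl.trans hθ) hθ
  have hcont := (continuous_strainQuad_left hsol ht e₀).continuousAt (x := x₀)
  have hopen : Ioi (max l₀ (κ * M₀)) ∈ 𝓝 (strainQuad u t x₀ e₀) := Ioi_mem_nhds hlt
  obtain ⟨R, hR, hball⟩ := Metric.mem_nhds_iff.1 (hcont.preimage_mem_nhds hopen)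
  have hseg_all : ∀ z ∈ ball x₀ R, ∃ e : EuclideanSpace ℝ (Fin 3), ‖e‖ = 1 ∧
      ∀ y, 0 ≤ newtonNearHess r₀ r₁ e e (z - y) * (qDensity u t y - qDensity u t z) := by
    intro z hz
    have hzv : max l₀ (κ * M₀) < strainQuad u t z e₀ := hball hz
    refine ⟨e₀, hx₀.1, hD11 z e₀ ⟨hx₀.1, fun y e' he' => ?_⟩ (lt_of_le_of_lt (le_max_left _ _) hzv)⟩
    have hy : (1 - δ') * strainQuad u t y e' ≤ M₀ := hx₀.2 y e' he'
    calc (1 - δ) * strainQuad u t y e' = κ * ((1 - δ') * strainQuad u t y e') := by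
          rw [hκ, ← mul_assoc, div_mul_cancel₀ _ h1δ'.ne']
      _ ≤ κ * M₀ := by gcongr
      _ ≤ strainQuad u t z e₀ := ((le_max_right _ _).trans_lt hzv).le
  exact ⟨R, hR, fun x hx => qDensity_eq_of_segregated_on_ball hsol ht hr₀ hr₁ hseg_all hx (mem_ball_self hR)⟩

/-- ★★ The same with the LITERAL hypothesis of door D11 `MagicConeDoor` at time `t` (segregation ∧ pointwise parity):
around every `δ'`-almost record point with level margin, `q = Δp` is constant on a ball. -/
theorem qDensity_locallyConst_of_magicCone_hypothesis {ν T : ℝ} {u : ℝ → (EuclideanSpace ℝ (Fin 3)) → (EuclideanSpace ℝ (Fin 3))}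
    {p : ℝ → (EuclideanSpace ℝ (Fin 3)) → ℝ} (hsol : IsClassicalNSSolutionOn (Ico 0 T) ν 0 u p) {t : ℝ} (ht : t ∈ Ico 0 T)
    {δ δ' l₀ r₀ r₁ : ℝ} (hl₀ : 0 < l₀) (hδ'δ : δ' < δ) (hδ1 : δ < 1) (hr₀ : 0 < r₀) (hr₁ : r₀ < r₁)
    (hD11 : ∀ x e, IsStrainAlmostArgmax δ u t x e → l₀ < strainQuad u t x e →
      (∀ y, 0 ≤ newtonNearHess r₀ r₁ e e (x - y) * (qDensity u t y - qDensity u t x)) ∧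
        ‖curl (u t) x‖ ^ 2 - ⟪curl (u t) x, e⟫ ^ 2 ≤ 4 * strainQuad u t x e ^ 2)
    {x₀ e₀ : EuclideanSpace ℝ (Fin 3)} (hx₀ : IsStrainAlmostArgmax δ' u t x₀ e₀)
    (hl : l₀ < (1 - δ) / (1 - δ') * strainQuad u t x₀ e₀) :
    ∃ R > 0, ∀ x ∈ ball x₀ R, qDensity u t x = qDensity u t x₀ :=
  qDensity_locallyConst_of_D11_hypothesis hsol ht hl₀ hδ'δ hδ1 hr₀ hr₁
    (fun x e hx hlx => (hD11 x e hx hlx).1) hx₀ hl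

/-! ## §25  Modulo spatial analyticity, D11's antecedent kills `q = Δp` at the time: `½|ω|² ≡ |S|²`, `Δp ≡ 0`

Mild solutions are real-analytic in space at positive times (Masuda 1967, Kahane 1969, Foias–Temam 1989; Lemarié-Rieusset
2016 Thm 9.12).  We do not type that fact; we take analyticity of `q(t,·)` and its integrability (finite enstrophy) as explicit
hypotheses and show that D11's segregation hypothesis at time `t` then forces `q(t,·) ≡ 0` on `ℝ³`. -/

/-- support: an integrable function on `ℝ³` that is constant is zero (Lebesgue measure of `ℝ³` is infinite). -/
theorem eq_zero_of_integrable_of_forall_eq {f : EuclideanSpace ℝ (Fin 3) → ℝ} (hint : Integrable f) {c : ℝ}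
    (hc : ∀ x, f x = c) : ∀ x, f x = 0 := by
  have hf : f = fun _ => c := funext hc
  rw [hf] at hint ⊢
  intro _
  rcases integrable_const_iff.1 hint with h0 | hfin
  · exact h0
  · exfalso
    have htop : (volume : Measure (EuclideanSpace ℝ (Fin 3))) univ = ⊤ := measure_univ_of_isAddLeftInvariant _
    exact absurd htop (measure_lt_top _ _).ne

/-- ★★ D11 MODULO ANALYTICITY.  Assume the segregation half of D11's hypothesis at a time `t`, a charged `δ'`-almost record
point with level margin (`δ' < δ`), and that `q(t,·) = ½|ω|² − |S|²` is real-analytic on `ℝ³` and integrable (both hold for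
finite-energy mild solutions at `t > 0`, by the literature).  Then `q(t,·) ≡ 0`: `|S|² = ½|ω|²` at EVERY point of space, and
`Δp(t,·) ≡ 0`. -/
theorem qDensity_eq_zero_of_D11_hypothesis_of_analytic {ν T : ℝ} {u : ℝ → (EuclideanSpace ℝ (Fin 3)) → (EuclideanSpace ℝ (Fin 3))}
    {p : ℝ → (EuclideanSpace ℝ (Fin 3)) → ℝ} (hsol : IsClassicalNSSolutionOn (Ico 0 T) ν 0 u p) {t : ℝ} (ht : t ∈ Ico 0 T)
    {δ δ' l₀ r₀ r₁ : ℝ} (hl₀ : 0 < l₀) (hδ'δ : δ' < δ) (hδ1 : δ < 1) (hr₀ : 0 < r₀) (hr₁ : r₀ < r₁)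
    (hD11 : ∀ x e, IsStrainAlmostArgmax δ u t x e → l₀ < strainQuad u t x e →
      ∀ y, 0 ≤ newtonNearHess r₀ r₁ e e (x - y) * (qDensity u t y - qDensity u t x))
    {x₀ e₀ : EuclideanSpace ℝ (Fin 3)} (hx₀ : IsStrainAlmostArgmax δ' u t x₀ e₀)
    (hl : l₀ < (1 - δ) / (1 - δ') * strainQuad u t x₀ e₀)
    (han : AnalyticOnNhd ℝ (qDensity u t) univ) (hint : Integrable (qDensity u t)) :
    (∀ x, qDensity u t x = 0) ∧ ∀ x, (Δ (p t)) x = 0 := by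
  obtain ⟨R, hR, hball⟩ := qDensity_locallyConst_of_D11_hypothesis hsol ht hl₀ hδ'δ hδ1 hr₀ hr₁ hD11 hx₀ hl
  -- identity theorem: `q(t,·)` agrees with the constant `q(t,x₀)` near `x₀`, hence everywhere
  have hev : (qDensity u t) =ᶠ[𝓝 x₀] fun _ => qDensity u t x₀ :=
    Filter.eventually_of_mem (ball_mem_nhds x₀ hR) fun x hx => hball x hx
  have hEq : EqOn (qDensity u t) (fun _ => qDensity u t x₀) univ :=
    han.eqOn_of_preconnected_of_eventuallyEq analyticOnNhd_const isPreconnected_univ (mem_univ x₀) hev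
  have hconst : ∀ x, qDensity u t x = qDensity u t x₀ := fun x => hEq (mem_univ x)
  have hzero : ∀ x, qDensity u t x = 0 := eq_zero_of_integrable_of_forall_eq hint hconst
  refine ⟨hzero, fun x => ?_⟩
  have hq : qDensity u t = fun y => (Δ (p t)) y := qDensity_eq_laplacian_pressure_fun hsol ht
  have := hzero x
  rwa [hq] at this

end Summit.NavierStokesRegularity.NavierStokesRegularity.Theorems.StrainDoors

end
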